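import Literature.MathematicalPhysics.QuantumLattice.HeisenbergOrderNeelProofs
import Literature.MathematicalPhysics.QuantumLattice.PerronFrobeniusGroundState
import HarnessLib

/-!
# Björnberg–Ueltschi, Lemma A.1 in the ground state: `|⟨S²S²⟩| ≤ ⟨S¹S¹⟩ ≤ ⟨S³S³⟩`

Sibling proof file of `XYZGroundStateOrder.lean` / `XYZGroundStateOrderProofs.lean` (named fact
`bjornbergUeltschi2022_ground_lro`). No statement of the tree is changed and no named fact is
introduced. This file proves the correlation inequalities (PF) consumed by
`xyz_lro_of_infraredBound`:

* B–U **Lemma A.1** (p. 25: "Assume that `|J²_{x-y}| ≤ J¹_{x-y}`. Then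
  `|⟨S²_0S²_x⟩| ≤ ⟨S¹_0S¹_x⟩`"), for the tracial ground state (`β = ∞`) of the nearest-neighbour
  bond Hamiltonian `H' = -Σ_{⟨xy⟩}(J₁b⁰ + J₂b¹ + J₃b²)` with `|J₂| ≤ J₁`
  (`xyz_abs_groundCorr_one_le_zero`), and its rotated form `|⟨S¹S¹⟩| ≤ ⟨S³S³⟩` for `|J₁| ≤ J₃`
  (`xyz_abs_groundCorr_zero_le_two`, B–U eq. (4.42) and (4.30): "this is where we use that
  `J³ ≥ J¹ ≥ -J² ≥ 0`"), by the cyclic permutation of the spin axes (a product unitary);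
* the averaged forms `|e₁| ≤ e₀ ≤ e₂` on even tori (`xyz_bondCorr_ineq`).

## The proof (a ground-state version of B–U's argument)

B–U prove Lemma A.1 at `β < ∞` by the Trotter formula: in the basis where `S³` is diagonal all
matrix elements of `e^{-βH}` are nonnegative because (A.3)
`J¹S¹_yS¹_z + J²S²_yS²_z = ¼(J¹-J²)(S⁺S⁺ + S⁻S⁻) + ¼(J¹+J²)(S⁺S⁻ + S⁻S⁺)` has nonnegative entries,
while the entries of `S²_0S²_x` are dominated by those of `S¹_0S¹_x`. We run the same positivity
argument directly on the ground-state projection `P₀` (so that no `β → ∞` limit is needed):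
* `Matrix.groundProj_apply_nonneg`: for a Hermitian matrix with real entries and nonpositive
  off-diagonal entries ("stoquastic"), every entry of `P₀` is real and `≥ 0`. Proof: the column
  `w = P₀eⱼ` is a ground vector; its entrywise modulus `|w|` has the same norm and no larger
  energy (the off-diagonal terms only decrease, `PerronFrobenius`-style), hence is a ground
  vector too (`mulVec_eq_smul_of_energy_le`); and `⟨w, |w|⟩ = |w|ⱼ = |P_{jj}| = ‖w‖²`, so equality
  holds in Cauchy–Schwarz and `w = |w| ≥ 0`;
* the entries of `H'` in the tensor basis: real, and `≤ 0` off the diagonal, by (A.3)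
  (`xyzBondHamiltonian₃_apply_re_nonpos`);
* `0 ≤ tr(P₀ M)` for entrywise-nonnegative `M`, applied to `S¹_xS¹_y ± S²_xS²_y`
  (`= ½(S⁺_xS⁻_y + S⁻_xS⁺_y)`, `½(S⁺_xS⁺_y + S⁻_xS⁻_y)` entrywise, `x ≠ y`);
* the frame change: `Matrix.groundStateFunctional_unitary_conj` (`ω_{UAUᴴ}(UOUᴴ) = ω_A(O)`) and
  the product unitary of the single-site cyclic axis permutation `Sˣ ↦ -Sᶻ ↦ Sʸ ↦ Sˣ`… built from
  the tree's quarter turns (`exists_unitary_conj_spinZ_eq_spinX`,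
  `exists_unitary_conj_spinX_eq_neg_spinY`), which maps `H'(J₁,J₂,J₃)` to `H'(J₂,J₃,J₁)`.

## References

* [BjornbergUeltschi2022] Lemma A.1 and eq. (A.3), p. 25–26; eqs. (4.30), (4.42).
* [KLS1988JSP] (real matrices `S¹`, `iS²`, `S³`).
-/

noncomputable section

open Matrix Finset
open scoped ComplexOrder
open Literature.MathematicalPhysics.QuantumLattice Literature.MathematicalPhysics.QuantumLattice.SpinOperators
  Literature.Probability.LatticeModels

/-! ### Linear algebra: covariance of the ground state, positivity of `P₀` for stoquastic matrices -/

namespace Matrix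

variable {m : Type*} [Fintype m] [DecidableEq m]

/-- **Characterisation of the ground-state projection**: a Hermitian matrix mapping into the ground
space and fixing it is `P₀`. [folklore] -/
theorem eq_groundProj_of_proj {A Q : Matrix m m ℂ} (hQh : Q.IsHermitian)
    (hQmem : ∀ w, Q *ᵥ w ∈ A.groundSpace) (hQfix : ∀ v ∈ A.groundSpace, Q *ᵥ v = v) :
    Q = A.groundProj := by
  have h1 : A.groundProj * Q = Q := by
    rw [ext_iff_mulVec]
    intro v
    rw [← mulVec_mulVec, groundProj_mulVec_of_mem A (hQmem v)]
  have h2 : Q * A.groundProj = A.groundProj := by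
    rw [ext_iff_mulVec]
    intro v
    rw [← mulVec_mulVec, hQfix _ (groundProj_mulVec_mem A v)]
  calc Q = Qᴴ := hQh.eq.symm
    _ = (A.groundProj * Q)ᴴ := by rw [h1]
    _ = Q * A.groundProj := by rw [conjTranspose_mul, hQh.eq, (groundProj_isHermitian A).eq]
    _ = A.groundProj := h2

/-- **The ground-state projection is covariant under unitary conjugation**:
`P₀(UAUᴴ) = U P₀(A) Uᴴ`. [folklore] -/
theorem groundProj_unitary_conj {A U : Matrix m m ℂ} (hU : U * Uᴴ = 1) (hU' : Uᴴ * U = 1) :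
    (U * A * Uᴴ).groundProj = U * A.groundProj * Uᴴ := by
  have hUmem : U ∈ Matrix.unitaryGroup m ℂ :=
    Matrix.mem_unitaryGroup_iff.2 (by rw [star_eq_conjTranspose]; exact hU)
  have hE : (U * A * Uᴴ).groundEnergy = A.groundEnergy := groundEnergy_unitary_conj hUmem
  set P := A.groundProj with hP
  symm
  refine eq_groundProj_of_proj ?_ ?_ ?_
  · -- Hermitian
    rw [IsHermitian, conjTranspose_mul, conjTranspose_mul, conjTranspose_conjTranspose,
      (groundProj_isHermitian A).eq, mul_assoc]
  · -- maps into the ground space of `UAUᴴ`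
    intro w
    rw [mem_groundSpace_iff, hE, mulVec_mulVec]
    have : U * A * Uᴴ * (U * P * Uᴴ) = (A.groundEnergy : ℂ) • (U * P * Uᴴ) := by
      calc U * A * Uᴴ * (U * P * Uᴴ) = U * A * (Uᴴ * U) * P * Uᴴ := by simp only [mul_assoc]
        _ = U * (A * P) * Uᴴ := by rw [hU', mul_one, mul_assoc U A P]
        _ = (A.groundEnergy : ℂ) • (U * P * Uᴴ) := by
            rw [hP, mul_groundProj, Matrix.mul_smul, Matrix.smul_mul, ← hP]
    rw [this, smul_mulVec]
  · -- fixes the ground space of `UAUᴴ`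
    intro v hv
    rw [mem_groundSpace_iff, hE] at hv
    have hv' : Uᴴ *ᵥ v ∈ A.groundSpace := by
      rw [mem_groundSpace_iff]
      have h := congrArg (fun z => Uᴴ *ᵥ z) hv
      simp only [mulVec_mulVec, mulVec_smul] at h
      rw [← mul_assoc, ← mul_assoc, hU', one_mul, ← mulVec_mulVec] at h
      exact h
    rw [← mulVec_mulVec, ← mulVec_mulVec, groundProj_mulVec_of_mem A hv', mulVec_mulVec, hU,
      one_mulVec]

/-- **The tracial ground state is covariant under unitary conjugation**:
`ω_{UAUᴴ}(UOUᴴ) = ω_A(O)`. [folklore] -/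
theorem groundStateFunctional_unitary_conj {A U : Matrix m m ℂ} (hU : U * Uᴴ = 1)
    (hU' : Uᴴ * U = 1) (O : Matrix m m ℂ) :
    (U * A * Uᴴ).groundStateFunctional (U * O * Uᴴ) = A.groundStateFunctional O := by
  rw [groundStateFunctional_apply, groundStateFunctional_apply, groundProj_unitary_conj hU hU']
  have h1 : (U * A.groundProj * Uᴴ).trace = A.groundProj.trace := by
    rw [trace_mul_cycle, hU', one_mul]
  have h2 : (U * A.groundProj * Uᴴ * (U * O * Uᴴ)).trace = (A.groundProj * O).trace := by
    have : U * A.groundProj * Uᴴ * (U * O * Uᴴ) = U * (A.groundProj * O) * Uᴴ := by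
      calc U * A.groundProj * Uᴴ * (U * O * Uᴴ) = U * A.groundProj * (Uᴴ * U) * O * Uᴴ := by
            simp only [mul_assoc]
        _ = U * (A.groundProj * O) * Uᴴ := by rw [hU', mul_one, mul_assoc U]
    rw [this, trace_mul_cycle, hU', one_mul]
  rw [h1, h2]

omit [DecidableEq m] in
/-- `Re ⟨v, A w⟩ = Σᵢⱼ Re(Aᵢⱼ) · Re(v̄ᵢ wⱼ)` for a matrix with real entries. [folklore] -/
theorem re_star_dotProduct_mulVec_of_im_eq_zero {A : Matrix m m ℂ} (hreal : ∀ i j, (A i j).im = 0)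
    (v w : m → ℂ) :
    (star v ⬝ᵥ A *ᵥ w).re = ∑ i, ∑ j, (A i j).re * ((starRingEnd ℂ) (v i) * w j).re := by
  simp only [dotProduct, mulVec, Pi.star_apply, Complex.star_def, Complex.re_sum, Finset.mul_sum]
  refine Finset.sum_congr rfl fun i _ => Finset.sum_congr rfl fun j _ => ?_
  simp only [Complex.mul_re, Complex.mul_im, hreal i j, Complex.conj_re, Complex.conj_im]
  ring

/-- `Re(v̄ w) ≤ |v| |w|`. [folklore] -/
theorem re_conj_mul_le_norm_mul_norm (v w : ℂ) : ((starRingEnd ℂ) v * w).re ≤ ‖v‖ * ‖w‖ := by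
  calc ((starRingEnd ℂ) v * w).re ≤ ‖(starRingEnd ℂ) v * w‖ := Complex.re_le_norm _
    _ = ‖v‖ * ‖w‖ := by rw [norm_mul, Complex.norm_conj]

/-- **Positivity of the ground-state projection of a stoquastic matrix.** If `H` is Hermitian
with real entries and nonpositive off-diagonal entries, then every entry of `P₀(H)` is real and
nonnegative (`0 ≤ P₀ᵢⱼ` in the star order of `ℂ`). No irreducibility is assumed (with it, this is
the Perron–Frobenius theorem of `PerronFrobeniusGroundState.lean`). This is the `β = ∞` form of
the positivity of `e^{-βH}` used by Björnberg–Ueltschi, Lemma A.1.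
[cite: BjornbergUeltschi2022, Lemma A.1 (proof)] -/
theorem groundProj_apply_nonneg {H : Matrix m m ℂ} (hH : H.IsHermitian)
    (hreal : ∀ i j, (H i j).im = 0) (hoff : ∀ i j, i ≠ j → (H i j).re ≤ 0) (i j : m) :
    0 ≤ H.groundProj i j := by
  set P := H.groundProj with hP
  set E := H.groundEnergy with hE
  have hPh : Pᴴ = P := (groundProj_isHermitian H).eq
  -- the column `w = P eⱼ`
  set w : m → ℂ := P *ᵥ Pi.single j 1 with hw
  have hw_apply : ∀ k, w k = P k j := fun k => by
    rw [hw, mulVec_single_one, col_apply]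
  have hw_mem : w ∈ H.groundSpace := groundProj_mulVec_mem H _
  -- its modulus `u = |w|`
  set r : m → ℝ := fun k => ‖w k‖ with hr
  set u : m → ℂ := fun k => ((r k : ℝ) : ℂ) with hu
  -- (1) energy lower bound `E ‖v‖² ≤ Re ⟨v, Hv⟩`
  have hEv : ∀ v : m → ℂ, E * (star v ⬝ᵥ v).re ≤ (star v ⬝ᵥ H *ᵥ v).re := by
    intro v
    have h := (posSemidef_sub_groundEnergy hH).dotProduct_mulVec_nonneg v
    rw [sub_mulVec, dotProduct_sub, Algebra.algebraMap_eq_smul_one, smul_mulVec, one_mulVec,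
      dotProduct_smul] at h
    obtain ⟨hre, -⟩ := Complex.nonneg_iff.mp h
    simp only [Complex.sub_re, Complex.real_smul, Complex.re_ofReal_mul] at hre
    rw [← hE] at hre
    linarith
  -- (2) `‖u‖ = ‖w‖` and `Re⟨u, Hu⟩ ≤ Re⟨w, Hw⟩`
  have hk : ∀ k, r k * r k = ((starRingEnd ℂ) (w k) * w k).re := by
    intro k
    rw [Complex.conj_mul', ← Complex.ofReal_pow, Complex.ofReal_re, sq]
  have hnorm : (star u ⬝ᵥ u).re = (star w ⬝ᵥ w).re := by
    rw [hu, PerronFrobenius.re_star_dotProduct_self_real]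
    simp only [dotProduct, Pi.star_apply, Complex.star_def, Complex.re_sum]
    exact Finset.sum_congr rfl fun k _ => hk k
  have henergy : (star u ⬝ᵥ H *ᵥ u).re ≤ (star w ⬝ᵥ H *ᵥ w).re := by
    rw [hu, PerronFrobenius.re_star_dotProduct_mulVec_real, re_star_dotProduct_mulVec_of_im_eq_zero hreal]
    refine Finset.sum_le_sum fun k _ => Finset.sum_le_sum fun l _ => ?_
    by_cases hkl : k = l
    · subst hkl
      rw [hk]
    · exact mul_le_mul_of_nonpos_left (re_conj_mul_le_norm_mul_norm _ _) (hoff k l hkl)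
  -- (3) hence `u` is a ground vector
  have hwE : (star w ⬝ᵥ H *ᵥ w).re = E * (star w ⬝ᵥ w).re := by
    rw [(mem_groundSpace_iff H w).1 hw_mem, dotProduct_smul, smul_eq_mul, Complex.re_ofReal_mul]
  have hu_le : (star u ⬝ᵥ H *ᵥ u).re ≤ E * (star u ⬝ᵥ u).re := by
    rw [hnorm, ← hwE]
    exact henergy
  have hu_mem : u ∈ H.groundSpace := by
    rw [mem_groundSpace_iff, ← hE]
    exact mulVec_eq_smul_of_energy_le hH.eq hEv hu_le
  have hPu : P *ᵥ u = u := groundProj_mulVec_of_mem H hu_mem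
  -- (4) `⟨w, u⟩ = u j = |w j|` and `w j = ⟨w, w⟩`
  have hstar_single : star (Pi.single j (1 : ℂ) : m → ℂ) = Pi.single j 1 := by
    rw [← Pi.single_star, star_one]
  have hwu : star w ⬝ᵥ u = u j := by
    rw [hw, star_mulVec, hPh, ← dotProduct_mulVec, hPu, hstar_single, single_dotProduct, one_mul]
  have hww : star w ⬝ᵥ w = w j := by
    rw [hw, star_mulVec, hPh, ← dotProduct_mulVec, mulVec_mulVec, groundProj_mul_self, ← hw,
      hstar_single, single_dotProduct, one_mul]
  -- `⟨w, w⟩` is real and nonnegative, so `u j = |w j| = w j = ⟨w, w⟩`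
  have hww0 : 0 ≤ star w ⬝ᵥ w := dotProduct_star_self_nonneg w
  have huj : u j = star w ⬝ᵥ w := by
    rw [hu]
    simp only [hr]
    rw [hw_apply j, ← hw_apply j, ← hww]
    obtain ⟨hre, him⟩ := Complex.nonneg_iff.mp hww0
    apply Complex.ext
    · rw [Complex.ofReal_re, Complex.norm_def, Complex.normSq_apply, ← him]
      simpa using Real.sqrt_mul_self hre
    · rw [Complex.ofReal_im, ← him]
  -- (5) `u = w`: `‖u - w‖² = ‖u‖² + ‖w‖² - 2 Re⟨w, u⟩ = 0`
  have huw : u = w := by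
    have h0 : star (u - w) ⬝ᵥ (u - w) = 0 := by
      have hsu : star u ⬝ᵥ w = star (star w ⬝ᵥ u) := star_dotProduct u w
      rw [star_sub, sub_dotProduct, dotProduct_sub, dotProduct_sub, hsu, hwu, huj]
      -- everything is the real number `⟨w, w⟩`
      have hreal_ww : star (star w ⬝ᵥ w) = star w ⬝ᵥ w := by
        obtain ⟨-, him⟩ := Complex.nonneg_iff.mp hww0
        exact Complex.conj_eq_iff_im.2 him.symm
      have huu : star u ⬝ᵥ u = star w ⬝ᵥ w := by
        apply Complex.ext
        · exact hnorm
        · obtain ⟨-, him⟩ := Complex.nonneg_iff.mp hww0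
          obtain ⟨-, him'⟩ := Complex.nonneg_iff.mp (dotProduct_star_self_nonneg u)
          rw [← him, ← him']
      rw [hreal_ww, huu]
      ring
    exact sub_eq_zero.1 (dotProduct_star_self_eq_zero.1 h0)
  -- (6) conclusion
  have : P i j = u i := by rw [← hw_apply i, ← huw]
  rw [this, hu]
  exact Complex.zero_le_real.2 (norm_nonneg _)

omit [DecidableEq m] in
/-- For an entrywise-nonnegative `P` and an entrywise-nonnegative `M`, `0 ≤ tr(P M)`. [folklore] -/
theorem trace_mul_nonneg_of_apply_nonneg {P M : Matrix m m ℂ} (hP : ∀ i j, 0 ≤ P i j)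
    (hM : ∀ i j, 0 ≤ M i j) : 0 ≤ (P * M).trace := by
  rw [trace]
  refine Finset.sum_nonneg fun i _ => ?_
  rw [diag_apply, mul_apply]
  exact Finset.sum_nonneg fun k _ => mul_nonneg (hP i k) (hM k i)

/-- **Domination of ground-state expectations by entrywise domination.** For a stoquastic Hermitian
`H` (real entries, nonpositive off-diagonal) and matrices with `M ± M'` entrywise nonnegative,
`|Re ω(M')| ≤ Re ω(M)` in the tracial ground state of `H`.
[cite: BjornbergUeltschi2022, Lemma A.1 (proof, eq. (A.4))] -/
theorem abs_re_groundStateFunctional_le_of_apply {H M M' : Matrix m m ℂ} [Nonempty m]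
    (hH : H.IsHermitian) (hreal : ∀ i j, (H i j).im = 0) (hoff : ∀ i j, i ≠ j → (H i j).re ≤ 0)
    (hplus : ∀ i j, 0 ≤ (M + M') i j) (hminus : ∀ i j, 0 ≤ (M - M') i j) :
    |(H.groundStateFunctional M').re| ≤ (H.groundStateFunctional M).re := by
  have hP := groundProj_apply_nonneg hH hreal hoff
  have htr := trace_groundProj_pos hH
  obtain ⟨htr_re, htr_im⟩ := Complex.pos_iff.mp htr
  have hinv_re : ∀ z : ℂ, ((H.groundProj.trace)⁻¹ * z).re = z.re / (H.groundProj.trace).re := by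
    intro z
    have : H.groundProj.trace = ((H.groundProj.trace).re : ℂ) :=
      Complex.ext (by simp) (by simp [← htr_im])
    rw [this, ← Complex.ofReal_inv, Complex.re_ofReal_mul]
    simp only [Complex.ofReal_re]
    rw [div_eq_inv_mul]
  have key : ∀ N : Matrix m m ℂ, (∀ i j, 0 ≤ N i j) → 0 ≤ (H.groundStateFunctional N).re := by
    intro N hN
    rw [groundStateFunctional_apply, hinv_re]
    exact div_nonneg (Complex.nonneg_iff.mp (trace_mul_nonneg_of_apply_nonneg hP hN)).1 htr_re.le
  have h1 := key _ hplus
  have h2 := key _ hminus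
  rw [map_add, Complex.add_re] at h1
  rw [map_sub, Complex.sub_re] at h2
  rw [abs_le]
  constructor <;> linarith

end Matrix

namespace Literature.MathematicalPhysics.QuantumLattice

variable {d : ℕ}

/-! ### Entries of products of two single-site operators -/

section Entries

variable {Λ : Type*} [Fintype Λ] [DecidableEq Λ] {q : ℕ}

/-- Entries of `a_x b_y` at distinct sites: `⟨σ| a_x b_y |τ⟩ = a_{σ_x τ_x} b_{σ_y τ_y} · δ` with
`δ = ∏_{z ≠ x, y} 𝟙_{σ_z τ_z} ∈ {0, 1}`. Tasaki (2020) §2.2. [folklore] -/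
theorem onSite_mul_onSite_apply_prod_one {x y : Λ} (hxy : x ≠ y) (a b : Matrix (Fin q) (Fin q) ℂ)
    (σ τ : TensorIndex Λ q) :
    (onSite x a * onSite y b : Op Λ q) σ τ = a (σ x) (τ x) * b (σ y) (τ y) *
      ∏ z ∈ (univ.erase x).erase y, (1 : Matrix (Fin q) (Fin q) ℂ) (σ z) (τ z) := by
  rw [onSite_mul_onSite_eq_productOp hxy, productOp_apply, ← mul_prod_erase _ _ (mem_univ x),
    ← mul_prod_erase _ _ (mem_erase.2 ⟨hxy.symm, mem_univ y⟩), Function.update_self,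
    Function.update_of_ne hxy.symm, Function.update_self, mul_assoc]
  congr 2
  refine prod_congr rfl fun z hz => ?_
  obtain ⟨hzy, hz'⟩ := mem_erase.1 hz
  obtain ⟨hzx, -⟩ := mem_erase.1 hz'
  rw [Function.update_of_ne hzx, Function.update_of_ne hzy]

/-- The Kronecker factor `δ = ∏_{z ≠ x, y} 𝟙_{σ_z τ_z}` is `0` or `1`; in particular real and
nonnegative. [folklore] -/
theorem prod_one_apply_nonneg (s : Finset Λ) (σ τ : TensorIndex Λ q) :
    ∃ c : ℝ, 0 ≤ c ∧ (∏ z ∈ s, (1 : Matrix (Fin q) (Fin q) ℂ) (σ z) (τ z)) = (c : ℂ) := by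
  by_cases h : ∀ z ∈ s, σ z = τ z
  · refine ⟨1, zero_le_one, ?_⟩
    rw [Complex.ofReal_one]
    exact prod_eq_one fun z hz => by rw [h z hz, one_apply_eq]
  · push Not at h
    obtain ⟨z, hz, hne⟩ := h
    refine ⟨0, le_rfl, ?_⟩
    rw [Complex.ofReal_zero]
    exact prod_eq_zero hz (one_apply_ne hne)

/-- The entries of `S⁺` are real and nonnegative. Tasaki (2020) §2.1, eq. (2.1.6). [folklore] -/
theorem spinRaise_apply_real_nonneg (n : ℕ) (k l : Fin (n + 1)) :
    ∃ t : ℝ, 0 ≤ t ∧ spinRaise n k l = (t : ℂ) := by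
  rw [spinRaise_apply]
  split_ifs
  · exact ⟨_, Real.sqrt_nonneg _, rfl⟩
  · exact ⟨0, le_rfl, by simp⟩

/-- The entries of `S⁻` are real and nonnegative. Tasaki (2020) §2.1, eq. (2.1.6). [folklore] -/
theorem spinLower_apply_real_nonneg (n : ℕ) (k l : Fin (n + 1)) :
    ∃ t : ℝ, 0 ≤ t ∧ spinLower n k l = (t : ℂ) := by
  rw [spinLower_apply]
  split_ifs
  · exact ⟨_, Real.sqrt_nonneg _, rfl⟩
  · exact ⟨0, le_rfl, by simp⟩

/-- The entries of `Sᶻ` are real. Tasaki (2020) §2.1, eq. (2.1.5). [folklore] -/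
theorem spinZ_apply_real (n : ℕ) (k l : Fin (n + 1)) :
    ∃ t : ℝ, SpinOperators.spinZ n k l = (t : ℂ) := by
  rw [spinZ_apply]
  split_ifs
  · exact ⟨(n : ℝ) / 2 - (k : ℕ), by push_cast; rfl⟩
  · exact ⟨0, by simp⟩

/-- Entries of `Sˣ = (S⁺ + S⁻)/2`. Tasaki (2020) §2.1, eq. (2.1.6). [folklore] -/
private theorem spinX_apply' (n : ℕ) (k l : Fin (n + 1)) :
    spinX n k l = 1 / 2 * (spinRaise n k l + spinLower n k l) := by
  simp only [spinX, Matrix.smul_apply, Matrix.add_apply, smul_eq_mul]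

/-- Entries of `Sʸ = (S⁺ - S⁻)/(2i)`. Tasaki (2020) §2.1, eq. (2.1.6). [folklore] -/
private theorem spinY_apply' (n : ℕ) (k l : Fin (n + 1)) :
    spinY n k l = 1 / (2 * Complex.I) * (spinRaise n k l - spinLower n k l) := by
  simp only [spinY, Matrix.smul_apply, Matrix.sub_apply, smul_eq_mul]

/-- **Entries of the `1–1` and `2–2` bond products through the ladder operators** (B–U (A.3)): at
distinct sites, with `p = S⁺_{σ_xτ_x}`, `q = S⁻_{σ_xτ_x}`, `p' = S⁺_{σ_yτ_y}`, `q' = S⁻_{σ_yτ_y}`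
(all `≥ 0`) and the Kronecker factor `δ ≥ 0`,
`⟨σ|Sˣ_xSˣ_y|τ⟩ = ¼(p+q)(p'+q')δ` and `⟨σ|Sʸ_xSʸ_y|τ⟩ = -¼(p-q)(p'-q')δ`.
[cite: BjornbergUeltschi2022, eq. (A.3)] -/
theorem siteSpin_mul_apply_ladder (n : ℕ) {x y : Λ} (hxy : x ≠ y)
    (σ τ : TensorIndex Λ (n + 1)) :
    ∃ p q p' q' δ : ℝ, 0 ≤ p ∧ 0 ≤ q ∧ 0 ≤ p' ∧ 0 ≤ q' ∧ 0 ≤ δ ∧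
      (siteSpin n x 0 * siteSpin n y 0) σ τ = (((p + q) * (p' + q') * δ / 4 : ℝ) : ℂ) ∧
      (siteSpin n x 1 * siteSpin n y 1) σ τ = ((-((p - q) * (p' - q') * δ / 4) : ℝ) : ℂ) := by
  obtain ⟨p, hp, hpe⟩ := spinRaise_apply_real_nonneg n (σ x) (τ x)
  obtain ⟨q, hq, hqe⟩ := spinLower_apply_real_nonneg n (σ x) (τ x)
  obtain ⟨p', hp', hpe'⟩ := spinRaise_apply_real_nonneg n (σ y) (τ y)
  obtain ⟨q', hq', hqe'⟩ := spinLower_apply_real_nonneg n (σ y) (τ y)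
  obtain ⟨δ, hδ, hδe⟩ := prod_one_apply_nonneg (q := n + 1) ((univ.erase x).erase y) σ τ
  refine ⟨p, q, p', q', δ, hp, hq, hp', hq', hδ, ?_, ?_⟩
  · rw [siteSpin, siteSpin, onSite_mul_onSite_apply_prod_one hxy, hδe, spinVec_zero, spinX_apply', spinX_apply',
      hpe, hqe, hpe', hqe']
    push_cast
    ring
  · rw [siteSpin, siteSpin, onSite_mul_onSite_apply_prod_one hxy, hδe, spinVec_one, spinY_apply', spinY_apply',
      hpe, hqe, hpe', hqe']
    have hI : (1 / (2 * Complex.I)) * (1 / (2 * Complex.I)) = -(1 / 4 : ℂ) := by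
      field_simp
      rw [Complex.I_sq]
      ring
    push_cast
    linear_combination ((p : ℂ) - q) * ((p' : ℂ) - q') * (δ : ℂ) * hI

/-- **Entries of the `3–3` bond product**: real, and zero off the diagonal (`Sᶻ` is diagonal).
[folklore] -/
theorem siteSpin_two_mul_apply (n : ℕ) {x y : Λ} (hxy : x ≠ y) (σ τ : TensorIndex Λ (n + 1)) :
    ∃ t : ℝ, (siteSpin n x 2 * siteSpin n y 2) σ τ = (t : ℂ) ∧ (σ ≠ τ → t = 0) := by
  obtain ⟨a, hae⟩ := spinZ_apply_real n (σ x) (τ x)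
  obtain ⟨b, hbe⟩ := spinZ_apply_real n (σ y) (τ y)
  obtain ⟨δ, -, hδe⟩ := prod_one_apply_nonneg (q := n + 1) ((univ.erase x).erase y) σ τ
  refine ⟨a * b * δ, ?_, ?_⟩
  · rw [siteSpin, siteSpin, onSite_mul_onSite_apply_prod_one hxy, hδe, spinVec_two, hae, hbe]
    push_cast
    ring
  · intro hστ
    -- some coordinate differs
    obtain ⟨z, hz⟩ : ∃ z, σ z ≠ τ z := by
      by_contra h
      push Not at h
      exact hστ (funext h)
    by_cases hzx : z = x
    · subst hzx
      have : SpinOperators.spinZ n (σ z) (τ z) = 0 := by rw [spinZ_apply, if_neg hz]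
      rw [this] at hae
      have ha : a = 0 := by exact_mod_cast hae.symm
      rw [ha]; ring
    · by_cases hzy : z = y
      · subst hzy
        have : SpinOperators.spinZ n (σ z) (τ z) = 0 := by rw [spinZ_apply, if_neg hz]
        rw [this] at hbe
        have hb : b = 0 := by exact_mod_cast hbe.symm
        rw [hb]; ring
      · have hmem : z ∈ (univ.erase x).erase y := mem_erase.2 ⟨hzy, mem_erase.2 ⟨hzx, mem_univ z⟩⟩
        have h0 : (∏ w ∈ (univ.erase x).erase y, (1 : Matrix (Fin (n + 1)) (Fin (n + 1)) ℂ) (σ w) (τ w))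
            = 0 := prod_eq_zero hmem (one_apply_ne hz)
        rw [h0] at hδe
        have hδ : δ = 0 := by exact_mod_cast hδe.symm
        rw [hδ]; ring

end Entries

/-! ### The three-coupling bond Hamiltonian and its entries -/

section Three

variable {Λ : Type*} [Fintype Λ] [DecidableEq Λ]

/-- The bond operator with three couplings `J₁ b⁰ + J₂ b¹ + J₃ b²` (B–U's (2.4), one bond; the
frame change permutes the couplings cyclically, so all three are needed here).
[cite: BjornbergUeltschi2022, eq. (2.4)] -/
def xyzBond₃ (n : ℕ) (J₁ J₂ J₃ : ℝ) (x y : Λ) : Op Λ (n + 1) :=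
  (J₁ : ℂ) • spinBond n 0 x y + (J₂ : ℂ) • spinBond n 1 x y + (J₃ : ℂ) • spinBond n 2 x y

/-- Symmetry of the three-coupling bond operator. [folklore] -/
theorem xyzBond₃_comm (n : ℕ) (J₁ J₂ J₃ : ℝ) (x y : Λ) :
    xyzBond₃ n J₁ J₂ J₃ y x = xyzBond₃ n J₁ J₂ J₃ x y := by
  simp only [xyzBond₃, spinBond_comm]

/-- Hermiticity. [folklore] -/
theorem xyzBond₃_isHermitian (n : ℕ) (J₁ J₂ J₃ : ℝ) (x y : Λ) :
    (xyzBond₃ n J₁ J₂ J₃ x y).IsHermitian := by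
  unfold xyzBond₃
  refine (((spinBond_isHermitian n 0 x y).smul ?_).add
    ((spinBond_isHermitian n 1 x y).smul ?_)).add ((spinBond_isHermitian n 2 x y).smul ?_) <;>
  · rw [isSelfAdjoint_iff, Complex.star_def, Complex.conj_ofReal]

/-- **Entries of the bond operator** (B–U (A.3)): at distinct sites every entry of
`J₁b⁰ + J₂b¹ + J₃b²` is a real number, which off the diagonal equals
`¼δ[(J₁ - J₂)(pp' + qq') + (J₁ + J₂)(pq' + qp')] ≥ 0` when `|J₂| ≤ J₁`.
[cite: BjornbergUeltschi2022, eq. (A.3)] -/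
theorem xyzBond₃_apply (n : ℕ) (J₁ J₂ J₃ : ℝ) {x y : Λ} (hxy : x ≠ y)
    (σ τ : TensorIndex Λ (n + 1)) :
    ∃ t : ℝ, xyzBond₃ n J₁ J₂ J₃ x y σ τ = (t : ℂ) ∧
      (σ ≠ τ → -J₂ ≤ J₁ → J₂ ≤ J₁ → 0 ≤ t) := by
  obtain ⟨p, q, p', q', δ, hp, hq, hp', hq', hδ, h0, h1⟩ := siteSpin_mul_apply_ladder n hxy σ τ
  obtain ⟨t₂, h2, h2off⟩ := siteSpin_two_mul_apply n hxy σ τ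
  refine ⟨J₁ * ((p + q) * (p' + q') * δ / 4) + J₂ * (-((p - q) * (p' - q') * δ / 4)) + J₃ * t₂, ?_, ?_⟩
  · rw [xyzBond₃, spinBond_eq_mul_of_ne hxy, spinBond_eq_mul_of_ne hxy, spinBond_eq_mul_of_ne hxy,
      Matrix.add_apply, Matrix.add_apply, Matrix.smul_apply, Matrix.smul_apply, Matrix.smul_apply,
      h0, h1, h2]
    simp only [smul_eq_mul]
    push_cast
    ring
  · intro hστ hJ hJ'
    rw [h2off hστ, mul_zero, add_zero]
    have : J₁ * ((p + q) * (p' + q') * δ / 4) + J₂ * (-((p - q) * (p' - q') * δ / 4)) =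
        δ / 4 * ((J₁ - J₂) * (p * p' + q * q') + (J₁ + J₂) * (p * q' + q * p')) := by ring
    rw [this]
    have h3 : 0 ≤ (J₁ - J₂) * (p * p' + q * q') :=
      mul_nonneg (by linarith) (by positivity)
    have h4 : 0 ≤ (J₁ + J₂) * (p * q' + q * p') :=
      mul_nonneg (by linarith) (by positivity)
    positivity

end Three

/-- The three-coupling bond Hamiltonian `H'(J₁,J₂,J₃) = -Σ_{⟨xy⟩}(J₁b⁰ + J₂b¹ + J₃b²)` on the
torus. [cite: BjornbergUeltschi2022, eq. (2.4)] -/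
def xyzBondHamiltonian₃ (L : ℕ) [NeZero L] (n : ℕ) (J₁ J₂ J₃ : ℝ) : Op (TorusSite d L) (n + 1) :=
  -∑ e ∈ (torusGraph d L).edgeFinset,
    Sym2.lift ⟨fun x y => xyzBond₃ n J₁ J₂ J₃ x y, fun x y => (xyzBond₃_comm n J₁ J₂ J₃ y x)⟩ e

section ThreeTorus

variable (L : ℕ) [NeZero L] (n : ℕ)

/-- Hermiticity of `H'(J₁,J₂,J₃)`. [folklore] -/
theorem xyzBondHamiltonian₃_isHermitian (J₁ J₂ J₃ : ℝ) :
    (xyzBondHamiltonian₃ (d := d) L n J₁ J₂ J₃).IsHermitian := by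
  unfold xyzBondHamiltonian₃
  exact IsHermitian.neg (isHermitian_sum_lift _ _ fun x y => xyzBond₃_isHermitian n J₁ J₂ J₃ x y)

/-- Endpoints of an edge are distinct. [folklore] -/
theorem ne_of_mem_torus_edgeFinset {x y : TorusSite d L} (h : s(x, y) ∈ (torusGraph d L).edgeFinset) :
    x ≠ y := fun hxy =>
  SimpleGraph.not_isDiag_of_mem_edgeSet _ (SimpleGraph.mem_edgeFinset.1 h)
    (by rw [hxy]; exact Sym2.mk_isDiag_iff.2 rfl)

/-- **`H'` is stoquastic**: in the tensor basis all entries of `H'(J₁,J₂,J₃)` are real, and the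
off-diagonal ones are `≤ 0` when `|J₂| ≤ J₁` (B–U, proof of Lemma A.1: "the matrix elements of all
operators are nonnegative", for `-H'`). [cite: BjornbergUeltschi2022, Lemma A.1 (proof)] -/
theorem xyzBondHamiltonian₃_apply (J₁ J₂ J₃ : ℝ) (hJ : -J₂ ≤ J₁) (hJ' : J₂ ≤ J₁)
    (σ τ : TensorIndex (TorusSite d L) (n + 1)) :
    (xyzBondHamiltonian₃ (d := d) L n J₁ J₂ J₃ σ τ).im = 0 ∧
      (σ ≠ τ → (xyzBondHamiltonian₃ (d := d) L n J₁ J₂ J₃ σ τ).re ≤ 0) := by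
  have key : ∀ e ∈ (torusGraph d L).edgeFinset, ∃ t : ℝ,
      (Sym2.lift ⟨fun x y => xyzBond₃ n J₁ J₂ J₃ x y, fun x y => (xyzBond₃_comm n J₁ J₂ J₃ y x)⟩ e)
        σ τ = (t : ℂ) ∧ (σ ≠ τ → 0 ≤ t) := by
    intro e he
    induction e using Sym2.ind with
    | h x y =>
      obtain ⟨t, ht, ht'⟩ := xyzBond₃_apply n J₁ J₂ J₃ (ne_of_mem_torus_edgeFinset L he) σ τ
      exact ⟨t, by rw [Sym2.lift_mk]; exact ht, fun h => ht' h hJ hJ'⟩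
  choose! t ht ht' using key
  have hsum : xyzBondHamiltonian₃ (d := d) L n J₁ J₂ J₃ σ τ =
      -∑ e ∈ (torusGraph d L).edgeFinset, (t e : ℂ) := by
    rw [xyzBondHamiltonian₃, Matrix.neg_apply, Matrix.sum_apply]
    congr 1
    exact sum_congr rfl fun e he => ht e he
  constructor
  · rw [hsum, Complex.neg_im, Complex.im_sum]
    simp
  · intro hστ
    rw [hsum, Complex.neg_re, Complex.re_sum, neg_nonpos]
    exact sum_nonneg fun e he => by simpa using ht' e he hστ

end ThreeTorus

/-! ### Lemma A.1 in the ground state -/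

section LemmaA1

variable (L : ℕ) [NeZero L] (n : ℕ)

/-- **B–U Lemma A.1 at `β = ∞`**: for `|J₂| ≤ J₁` (any `J₃`) and `x ≠ y`,
`|Re ω(Sʸ_xSʸ_y)| ≤ Re ω(Sˣ_xSˣ_y)` in the tracial ground state of `H'(J₁,J₂,J₃)`: the
ground-state projection has nonnegative entries (`H'` is stoquastic) and
`Sˣ_xSˣ_y ± Sʸ_xSʸ_y` have nonnegative entries (`½(pq' + qp')δ`, `½(pp' + qq')δ`).
[cite: BjornbergUeltschi2022, Lemma A.1] -/
theorem xyz₃_abs_groundCorr_one_le_zero (J₁ J₂ J₃ : ℝ) (hJ : -J₂ ≤ J₁) (hJ' : J₂ ≤ J₁)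
    {x y : TorusSite d L} (hxy : x ≠ y) :
    |((xyzBondHamiltonian₃ (d := d) L n J₁ J₂ J₃).groundStateFunctional
        (siteSpin n x 1 * siteSpin n y 1)).re| ≤
      ((xyzBondHamiltonian₃ (d := d) L n J₁ J₂ J₃).groundStateFunctional
        (siteSpin n x 0 * siteSpin n y 0)).re := by
  refine Matrix.abs_re_groundStateFunctional_le_of_apply (xyzBondHamiltonian₃_isHermitian L n J₁ J₂ J₃)
    (fun σ τ => (xyzBondHamiltonian₃_apply L n J₁ J₂ J₃ hJ hJ' σ τ).1)
    (fun σ τ hστ => (xyzBondHamiltonian₃_apply L n J₁ J₂ J₃ hJ hJ' σ τ).2 hστ) ?_ ?_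
  · intro σ τ
    obtain ⟨p, q, p', q', δ, hp, hq, hp', hq', hδ, h0, h1⟩ := siteSpin_mul_apply_ladder n hxy σ τ
    rw [Matrix.add_apply, h0, h1, ← Complex.ofReal_add]
    refine Complex.zero_le_real.2 ?_
    have : (p + q) * (p' + q') * δ / 4 + -((p - q) * (p' - q') * δ / 4) = (p * q' + q * p') * δ / 2 := by
      ring
    rw [this]
    positivity
  · intro σ τ
    obtain ⟨p, q, p', q', δ, hp, hq, hp', hq', hδ, h0, h1⟩ := siteSpin_mul_apply_ladder n hxy σ τ
    rw [Matrix.sub_apply, h0, h1, ← Complex.ofReal_sub]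
    refine Complex.zero_le_real.2 ?_
    have : (p + q) * (p' + q') * δ / 4 - -((p - q) * (p' - q') * δ / 4) = (p * p' + q * q') * δ / 2 := by
      ring
    rw [this]
    positivity

end LemmaA1

/-! ### The cyclic permutation of the spin axes -/

section Frame

/-- **A single-site unitary permuting the spin axes cyclically** (up to signs):
`W Sˣ Wᴴ = -Sᶻ`, `W Sʸ Wᴴ = Sˣ`, `W Sᶻ Wᴴ = -Sʸ` — the quarter turn about the `2`-axis followed
by the quarter turn about the `3`-axis (B–U, proof of Prop. 2.4: "by combining rotations by an
angle `π/2`, we can choose `V_x` such that …"). [cite: BjornbergUeltschi2022, Proposition 2.4 (proof)] -/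
theorem exists_unitary_cyclicAxes (n : ℕ) :
    ∃ W : Matrix (Fin (n + 1)) (Fin (n + 1)) ℂ, W * Wᴴ = 1 ∧ Wᴴ * W = 1 ∧
      W * spinX n * Wᴴ = -SpinOperators.spinZ n ∧ W * spinY n * Wᴴ = spinX n ∧
      W * SpinOperators.spinZ n * Wᴴ = -spinY n := by
  obtain ⟨D, hD, hD', hDx, hDy, hDz⟩ := exists_unitary_conj_spinX_eq_neg_spinY n
  obtain ⟨V, hV, hV', hVz, hVx, hVy⟩ := exists_unitary_conj_spinZ_eq_spinX n
  have conj3 : ∀ A, D * V * A * (D * V)ᴴ = D * (V * A * Vᴴ) * Dᴴ := fun A => by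
    rw [conjTranspose_mul]; simp only [mul_assoc]
  refine ⟨D * V, ?_, ?_, ?_, ?_, ?_⟩
  · rw [conjTranspose_mul, mul_assoc, ← mul_assoc V, hV, one_mul, hD]
  · rw [conjTranspose_mul, mul_assoc, ← mul_assoc Dᴴ, hD', one_mul, hV']
  · rw [conj3, hVx, mul_neg, neg_mul, hDz]
  · rw [conj3, hVy, hDy]
  · rw [conj3, hVz, hDx]

variable (L : ℕ) [NeZero L] (n : ℕ)

/-- **The frame change on the torus.** The product unitary `U = ⨂_x W` of
`exists_unitary_cyclicAxes` maps `Sˣ_x ↦ -Sᶻ_x`, `Sʸ_x ↦ Sˣ_x`, `Sᶻ_x ↦ -Sʸ_x` and conjugates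
`H'(J₁,J₂,J₃)` into `H'(J₂,J₃,J₁)` (the bond terms transform as `b⁰ ↦ b²`, `b¹ ↦ b⁰`, `b² ↦ b¹`).
This is B–U's Proposition 2.4 for the permutation `ρ = (1 2 3)`, at the level of operators.
[cite: BjornbergUeltschi2022, Proposition 2.4] -/
theorem exists_frame_xyzBondHamiltonian₃ (J₁ J₂ J₃ : ℝ) :
    ∃ U : Op (TorusSite d L) (n + 1), U * Uᴴ = 1 ∧ Uᴴ * U = 1 ∧
      U * xyzBondHamiltonian₃ (d := d) L n J₁ J₂ J₃ * Uᴴ = xyzBondHamiltonian₃ L n J₂ J₃ J₁ ∧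
      (∀ x, U * siteSpin n x 0 * Uᴴ = -siteSpin n x 2) ∧
      (∀ x, U * siteSpin n x 1 * Uᴴ = siteSpin n x 0) ∧
      (∀ x, U * siteSpin n x 2 * Uᴴ = -siteSpin n x 1) := by
  obtain ⟨W, hW, hW', hWx, hWy, hWz⟩ := exists_unitary_cyclicAxes n
  set U : Op (TorusSite d L) (n + 1) := productOp (fun _ : TorusSite d L => W) with hU
  have hu : ∀ z : TorusSite d L, (fun _ : TorusSite d L => W) z * ((fun _ : TorusSite d L => W) z)ᴴ = 1 :=
    fun _ => hW
  have hu' : ∀ z : TorusSite d L, ((fun _ : TorusSite d L => W) z)ᴴ * (fun _ : TorusSite d L => W) z = 1 :=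
    fun _ => hW'
  have h0 : ∀ x : TorusSite d L, U * siteSpin n x 0 * Uᴴ = -siteSpin n x 2 := fun x => by
    rw [hU, productOp_conj_siteSpin hu, spinVec_zero, hWx, onSite_neg']
    rfl
  have h1 : ∀ x : TorusSite d L, U * siteSpin n x 1 * Uᴴ = siteSpin n x 0 := fun x => by
    rw [hU, productOp_conj_siteSpin hu, spinVec_one, hWy]
    rfl
  have h2 : ∀ x : TorusSite d L, U * siteSpin n x 2 * Uᴴ = -siteSpin n x 1 := fun x => by
    rw [hU, productOp_conj_siteSpin hu, spinVec_two, hWz, onSite_neg']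
    rfl
  have hb0 : ∀ x y : TorusSite d L, U * spinBond n 0 x y * Uᴴ = spinBond n 2 x y := fun x y => by
    rw [hU, productOp_conj_spinBond hu hu', spinVec_zero, hWx, onSite_neg', onSite_neg', neg_mul_neg,
      neg_mul_neg, spinBond]
    rfl
  have hb1 : ∀ x y : TorusSite d L, U * spinBond n 1 x y * Uᴴ = spinBond n 0 x y := fun x y => by
    rw [hU, productOp_conj_spinBond hu hu', spinVec_one, hWy, spinBond]
    rfl
  have hb2 : ∀ x y : TorusSite d L, U * spinBond n 2 x y * Uᴴ = spinBond n 1 x y := fun x y => by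
    rw [hU, productOp_conj_spinBond hu hu', spinVec_two, hWz, onSite_neg', onSite_neg', neg_mul_neg,
      neg_mul_neg, spinBond]
    rfl
  refine ⟨U, productOp_mul_conjTranspose hu, productOp_conjTranspose_mul hu', ?_, h0, h1, h2⟩
  rw [xyzBondHamiltonian₃, xyzBondHamiltonian₃, mul_neg, neg_mul, mul_sum, sum_mul]
  congr 1
  refine sum_congr rfl fun e _ => ?_
  induction e using Sym2.ind with
  | h x y =>
    rw [Sym2.lift_mk, Sym2.lift_mk]
    show U * xyzBond₃ n J₁ J₂ J₃ x y * Uᴴ = xyzBond₃ n J₂ J₃ J₁ x y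
    rw [xyzBond₃, xyzBond₃, mul_add, mul_add, add_mul, add_mul,
      mul_smul_comm, mul_smul_comm, mul_smul_comm, smul_mul_assoc, smul_mul_assoc, smul_mul_assoc,
      hb0, hb1, hb2]
    abel

/-- **The correlations in the rotated frame**: with `ω_J` the tracial ground state of `H'(J)`,
`ω_{(J₁,J₂,J₃)}(Sˣ_xSˣ_y) = ω_{(J₂,J₃,J₁)}(Sᶻ_xSᶻ_y)`, `ω_{(J₁,J₂,J₃)}(Sʸ_xSʸ_y) = ω_{(J₂,J₃,J₁)}(Sˣ_xSˣ_y)`,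
`ω_{(J₁,J₂,J₃)}(Sᶻ_xSᶻ_y) = ω_{(J₂,J₃,J₁)}(Sʸ_xSʸ_y)`.
[cite: BjornbergUeltschi2022, Proposition 2.4 ("one may transfer results … from one set of
coupling parameters to another")] -/
theorem xyz₃_groundStateFunctional_frame (J₁ J₂ J₃ : ℝ) (x y : TorusSite d L) :
    (xyzBondHamiltonian₃ (d := d) L n J₁ J₂ J₃).groundStateFunctional (siteSpin n x 0 * siteSpin n y 0) =
      (xyzBondHamiltonian₃ (d := d) L n J₂ J₃ J₁).groundStateFunctional (siteSpin n x 2 * siteSpin n y 2) ∧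
    (xyzBondHamiltonian₃ (d := d) L n J₁ J₂ J₃).groundStateFunctional (siteSpin n x 1 * siteSpin n y 1) =
      (xyzBondHamiltonian₃ (d := d) L n J₂ J₃ J₁).groundStateFunctional (siteSpin n x 0 * siteSpin n y 0) ∧
    (xyzBondHamiltonian₃ (d := d) L n J₁ J₂ J₃).groundStateFunctional (siteSpin n x 2 * siteSpin n y 2) =
      (xyzBondHamiltonian₃ (d := d) L n J₂ J₃ J₁).groundStateFunctional (siteSpin n x 1 * siteSpin n y 1) := by
  obtain ⟨U, hU, hU', hH, h0, h1, h2⟩ := exists_frame_xyzBondHamiltonian₃ (d := d) L n J₁ J₂ J₃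
  have key : ∀ O : Op (TorusSite d L) (n + 1),
      (xyzBondHamiltonian₃ (d := d) L n J₁ J₂ J₃).groundStateFunctional O =
        (xyzBondHamiltonian₃ (d := d) L n J₂ J₃ J₁).groundStateFunctional (U * O * Uᴴ) := by
    intro O
    rw [← hH, Matrix.groundStateFunctional_unitary_conj hU hU']
  have hmul : ∀ A B : Op (TorusSite d L) (n + 1), U * (A * B) * Uᴴ = (U * A * Uᴴ) * (U * B * Uᴴ) := by
    intro A B
    simp only [mul_assoc]
    rw [← mul_assoc Uᴴ U, hU', one_mul]
  refine ⟨?_, ?_, ?_⟩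
  · rw [key, hmul, h0, h0, neg_mul_neg]
  · rw [key, hmul, h1, h1]
  · rw [key, hmul, h2, h2, neg_mul_neg]

/-- **B–U Lemma A.1, rotated form** (eqs. (4.30), (4.42): "this is where we use that
`J³ ≥ J¹ ≥ -J² ≥ 0`"): for `|J₁| ≤ J₃` (any `J₂`) and `x ≠ y`,
`|Re ω(Sˣ_xSˣ_y)| ≤ Re ω(Sᶻ_xSᶻ_y)` in the tracial ground state of `H'(J₁,J₂,J₃)` — Lemma A.1
for the couplings `(J₃,J₁,J₂)` transported by two cyclic frame changes.
[cite: BjornbergUeltschi2022, Lemma A.1 and eq. (4.42)] -/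
theorem xyz₃_abs_groundCorr_zero_le_two (J₁ J₂ J₃ : ℝ) (hJ : -J₁ ≤ J₃) (hJ' : J₁ ≤ J₃)
    {x y : TorusSite d L} (hxy : x ≠ y) :
    |((xyzBondHamiltonian₃ (d := d) L n J₁ J₂ J₃).groundStateFunctional
        (siteSpin n x 0 * siteSpin n y 0)).re| ≤
      ((xyzBondHamiltonian₃ (d := d) L n J₁ J₂ J₃).groundStateFunctional
        (siteSpin n x 2 * siteSpin n y 2)).re := by
  obtain ⟨ha0, -, ha2⟩ := xyz₃_groundStateFunctional_frame (d := d) L n J₁ J₂ J₃ x y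
  obtain ⟨-, hb1, hb2⟩ := xyz₃_groundStateFunctional_frame (d := d) L n J₂ J₃ J₁ x y
  rw [ha0, hb2, ha2, hb1]
  exact xyz₃_abs_groundCorr_one_le_zero L n J₃ J₁ J₂ hJ hJ' hxy

end Frame

end Literature.MathematicalPhysics.QuantumLattice
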